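import Mathlib.Combinatorics.Colex
import Mathlib.Data.Nat.Log
import Mathlib.FieldTheory.PrimitiveElement
import Mathlib.RingTheory.AdjoinRoot
import Mathlib.Algebra.Polynomial.Degree.Domain
import Literature.InformationTheory.Coding.BCHIndependence
import HarnessLib

/-!
# An explicit binary BCH parity-check matrix (Khot 2005, Thm. 4.1: "it can be constructed efficiently")

Topic `InformationTheory/Coding`, namespace `Literature.InformationTheory.Coding`. The companion
of `BCHIndependence.lean`: there, `exists_bch01Matrix` gives the EXISTENCE of a `{0,1}`-matrix with
`t·m` rows and `N` columns all of whose sets of `d = 2t` columns are independent over `GF(2)`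
(McEliece 2002, Thm. 9.1; Khot 2005, Thm. 4.1), over an abstract `GF(2^m)` (`GaloisField 2 m`,
an arbitrary `GF(2)`-basis, an arbitrary injection into the units). A reduction that OUTPUTS this
matrix (Khot's Thm. 5.1; the machine level of `Literature.Algebra.EuclideanLattices.
Khot2005_SAT_randReducible_gapSVP`) needs ONE SPECIFIC such matrix given by a definite finite
procedure. This file fixes it — `bchExplicit t M N`, over the field `GF(2^{M+1})` presented as
`𝔽₂[X]/(f_M)` with `f_M` the irreducible polynomial of degree `M + 1` of LEAST coefficient bitmask
— and proves (all statements, no facts):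

* `bitsPoly n = ∑_{i ∈ bits(n)} Xⁱ ∈ 𝔽₂[X]` (the polynomial whose coefficient vector is the binary
  expansion of `n`), its inverse `polyBits`, `coeff_bitsPoly`, `natDegree_bitsPoly = log₂ n`,
  `bitsPoly_injective`, `bitsPoly_polyBits`, `polyBits_bitsPoly`;
* `exists_irreducible_bitsPoly`: for `m ≥ 1` some `n ∈ [2^m, 2^{m+1})` has `bitsPoly n`
  irreducible (the minimal polynomial of a primitive element of `GaloisField 2 m`);
  `canonIrredBits M` = the least such `n` for `m = M + 1` (`Nat.find`; `canonIrredBits_spec`,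
  `canonIrredBits_min`), `canonIrred M = bitsPoly (canonIrredBits M)`: monic, irreducible,
  `natDegree = M + 1`;
* `GF2 M = AdjoinRoot (canonIrred M)`, a field of characteristic `2` with the power basis
  `GF2.basis M = (1, x, …, x^M)` (`AdjoinRoot.powerBasisAux'`), whose coordinates are the
  coefficients of the remainder modulo `f_M` (`GF2.basis_repr_mk`); the elements
  `GF2.elt M n = [bitsPoly n]`, pairwise distinct and nonzero for `1 ≤ n < 2^{M+1}`;
* `bchExplicit t M N := bch01Matrix (j ↦ GF2.elt M (j+1)) t (GF2.basis M)` — the binary BCH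
  parity-check matrix of `BCHIndependence.lean` for these data: entries in `{0,1}`
  (`bchExplicit_entry`), the ENTRY FORMULA `bchExplicit (s,l) j = coeff_l ((bitsPoly (j+1))^{2s+1}
  mod f_M)` (`bchExplicit_apply`: what a machine computes — carry-less polynomial arithmetic on
  bitmasks), and Khot's Thm. 4.1 for it (`bchExplicit_odd`: for `N < 2^{M+1}`, every integer
  vector with between `1` and `2t` odd entries has an image with an odd coordinate, i.e. any
  `d = 2t` columns are independent over `GF(2)`), by `bch01Matrix_odd`.

## Faithfulness / design notes

* Khot, Thm. 4.1: "The parity check matrix for BCH codes has this property and it can be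
  constructed efficiently." McEliece, Ch. 9: `GF(2^m)` is realised as `𝔽₂[x]/(f)` for an
  irreducible `f` of degree `m`, elements as coefficient `m`-tuples, the parity-check matrix of
  odd powers `α, α³, …, α^{2t-1}` of the column locators. The only conventions fixed here beyond
  the printed construction are WHICH irreducible `f` (the least bitmask; any works) and WHICH `N`
  nonzero locators (the elements with bitmasks `1, …, N`); both are the natural canonical choices
  and are what a search "first irreducible polynomial of degree `m` in increasing bitmask order"
  produces. Finding `f` by exhaustive search is polynomial in `2^m` (here `2^m ≍ N`, the number of
  columns), cf. `Polynomial.Monic.irreducible_iff_lt_natDegree_lt` (trial division by all monic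
  polynomials of degree `≤ m/2`).
* The degree is written `M + 1` (so that it is never `0` and no side condition is carried by the
  definitions); Khot's parameters are `t = d/2`, `m = M + 1 = ⌈log₂(N+1)⌉`.
* Mathlib: `Finset.equivBitIndices : ℕ ≃ Finset ℕ` (bitmask ↔ set of bit positions),
  `AdjoinRoot.powerBasisAux'` / `powerBasisAux'_repr_apply_to_fun` (coordinates = coefficients of
  the remainder), `GaloisField`, `Field.powerBasisOfFiniteOfSeparable` (existence of an
  irreducible polynomial of every degree `m ≥ 1` over `𝔽₂`, via a primitive element). Mathlib has
  no BCH codes and no canonical irreducible polynomials (searched `BCH`, `Conway`, `irreducible_of_degree`).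

## References

* R. J. McEliece, *The Theory of Information and Coding*, 2nd ed., CUP 2002, Ch. 9, §9.1
  (Thm. 9.1, BCH codes over `GF(2^m) = 𝔽₂[x]/(f)`).
* S. Khot, *Hardness of approximating the shortest vector problem in lattices*, J. ACM 52 (2005)
  789–808, Thm. 4.1.
-/

noncomputable section

namespace Literature.InformationTheory.Coding

open Polynomial Finset Matrix

/-! ### Binary polynomials as bitmasks -/

/-- The polynomial over `𝔽₂` whose coefficient vector is the binary expansion of `n`:
`bitsPoly n = ∑_{i : bit i of n is 1} Xⁱ` (so `bitsPoly 0b1011 = X³ + X + 1`).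
[cite: Mceliece2002, Ch. 9 §9.1] -/
def bitsPoly (n : ℕ) : (ZMod 2)[X] :=
  ∑ i ∈ Finset.equivBitIndices n, X ^ i

/-- Membership in the bit-position set of `n` is the bit test. [folklore] -/
theorem mem_equivBitIndices_iff (n i : ℕ) : i ∈ Finset.equivBitIndices n ↔ n.testBit i = true := by
  simp [Nat.mem_bitIndices]

/-- The coefficients of `bitsPoly n` are the bits of `n`. [folklore] -/
theorem coeff_bitsPoly (n i : ℕ) : (bitsPoly n).coeff i = if n.testBit i = true then 1 else 0 := by
  rw [bitsPoly, finsetSum_coeff]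
  simp only [coeff_X_pow]
  rw [Finset.sum_ite_eq]
  simp only [mem_equivBitIndices_iff]

/-- The support of `bitsPoly n` is the set of bit positions of `n`. [folklore] -/
theorem support_bitsPoly (n : ℕ) : (bitsPoly n).support = Finset.equivBitIndices n := by
  ext i
  rw [mem_support_iff, coeff_bitsPoly, mem_equivBitIndices_iff]
  by_cases h : n.testBit i = true
  · simp [h]
  · simp [h]

/-- `bitsPoly` is injective. [folklore] -/
theorem bitsPoly_injective : Function.Injective bitsPoly := fun n n' h => by
  apply Finset.equivBitIndices.injective
  rw [← support_bitsPoly, ← support_bitsPoly, h]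

/-- The bitmask of a binary polynomial: `polyBits p = ∑_{i ∈ supp p} 2ⁱ`. [folklore] -/
def polyBits (p : (ZMod 2)[X]) : ℕ :=
  Finset.equivBitIndices.symm p.support

/-- `polyBits p = ∑_{i ∈ supp p} 2ⁱ` (definitional). [folklore] -/
theorem polyBits_eq (p : (ZMod 2)[X]) : polyBits p = ∑ i ∈ p.support, 2 ^ i := rfl

/-- `polyBits` inverts `bitsPoly`. [folklore] -/
theorem polyBits_bitsPoly (n : ℕ) : polyBits (bitsPoly n) = n := by
  rw [polyBits, support_bitsPoly, Equiv.symm_apply_apply]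

/-- The bits of `polyBits p` are the (nonzero, i.e. `= 1`) coefficients of `p`. [folklore] -/
theorem testBit_polyBits_iff (p : (ZMod 2)[X]) (i : ℕ) : (polyBits p).testBit i = true ↔ p.coeff i ≠ 0 := by
  rw [← mem_support_iff, ← mem_equivBitIndices_iff, polyBits, Equiv.apply_symm_apply]

/-- `bitsPoly` inverts `polyBits`: every binary polynomial is `bitsPoly` of its bitmask.
[folklore] -/
theorem bitsPoly_polyBits (p : (ZMod 2)[X]) : bitsPoly (polyBits p) = p := by
  ext i
  rw [coeff_bitsPoly]
  by_cases h : p.coeff i = 0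
  · rw [if_neg (fun h' => (testBit_polyBits_iff p i).1 h' h), h]
  · rw [if_pos ((testBit_polyBits_iff p i).2 h)]
    generalize p.coeff i = x at h ⊢
    revert x
    decide

/-- `bitsPoly` is a bijection `ℕ ≃ 𝔽₂[X]` with inverse `polyBits`. [folklore] -/
def bitsPolyEquiv : ℕ ≃ (ZMod 2)[X] :=
  ⟨bitsPoly, polyBits, polyBits_bitsPoly, bitsPoly_polyBits⟩

/-- `bitsPoly 0 = 0`. [folklore] -/
@[simp] theorem bitsPoly_zero : bitsPoly 0 = 0 := by
  simp [bitsPoly]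

/-- `bitsPoly 1 = 1`. [folklore] -/
@[simp] theorem bitsPoly_one : bitsPoly 1 = 1 := by
  simp [bitsPoly]

/-- `bitsPoly n` has degree `< m` when `n < 2^m`. [folklore] -/
theorem degree_bitsPoly_lt {n m : ℕ} (h : n < 2 ^ m) : (bitsPoly n).degree < m := by
  rw [degree_lt_iff_coeff_zero]
  intro i hi
  rw [coeff_bitsPoly, Nat.testBit_lt_two_pow (h.trans_le (Nat.pow_le_pow_right (by norm_num) hi))]
  simp

/-- For `2^m ≤ n < 2^{m+1}`, `bitsPoly n` has degree exactly `m` … [folklore] -/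
theorem natDegree_bitsPoly_of_mem {n m : ℕ} (h1 : 2 ^ m ≤ n) (h2 : n < 2 ^ (m + 1)) :
    (bitsPoly n).natDegree = m := by
  have hbit : n.testBit m = true := by
    have hlt : n - 2 ^ m < 2 ^ m := by rw [pow_succ] at h2; omega
    rw [show n = 2 ^ m + (n - 2 ^ m) by omega, Nat.testBit_two_pow_add_eq, Nat.testBit_lt_two_pow hlt]
    rfl
  refine natDegree_eq_of_le_of_coeff_ne_zero ?_ ?_
  · rw [natDegree_le_iff_degree_le, degree_le_iff_coeff_zero]
    intro i hi
    have hi' : m + 1 ≤ i := by exact_mod_cast hi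
    rw [coeff_bitsPoly, Nat.testBit_lt_two_pow (h2.trans_le (Nat.pow_le_pow_right (by norm_num) hi'))]
    simp
  · rw [coeff_bitsPoly, if_pos hbit]
    exact one_ne_zero

/-- … and is monic. [folklore] -/
theorem monic_bitsPoly_of_mem {n m : ℕ} (h1 : 2 ^ m ≤ n) (h2 : n < 2 ^ (m + 1)) :
    (bitsPoly n).Monic := by
  have hbit : n.testBit m = true := by
    have hlt : n - 2 ^ m < 2 ^ m := by rw [pow_succ] at h2; omega
    rw [show n = 2 ^ m + (n - 2 ^ m) by omega, Nat.testBit_two_pow_add_eq, Nat.testBit_lt_two_pow hlt]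
    rfl
  rw [Monic, leadingCoeff, natDegree_bitsPoly_of_mem h1 h2, coeff_bitsPoly, if_pos hbit]

/-- The degree of `bitsPoly n` is `⌊log₂ n⌋` (the position of the leading bit; `0` for `n ≤ 1`).
[folklore] -/
theorem natDegree_bitsPoly (n : ℕ) : (bitsPoly n).natDegree = Nat.log 2 n := by
  rcases Nat.eq_zero_or_pos n with rfl | hn
  · simp
  · exact natDegree_bitsPoly_of_mem (Nat.pow_log_le_self 2 hn.ne') (Nat.lt_pow_succ_log_self (by norm_num) n)

/-- The bitmask of a polynomial of degree `< m` is `< 2^m`. [folklore] -/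
theorem polyBits_lt_two_pow {p : (ZMod 2)[X]} {m : ℕ} (h : p.degree < m) : polyBits p < 2 ^ m := by
  refine Nat.lt_pow_two_of_testBit _ fun i hi => ?_
  rw [Bool.eq_false_iff]
  intro h'
  have hc := (testBit_polyBits_iff p i).1 h'
  rw [degree_lt_iff_coeff_zero] at h
  exact hc (h i hi)

/-- The bitmask of a polynomial with a nonzero coefficient in degree `m` is `≥ 2^m`. [folklore] -/
theorem two_pow_le_polyBits {p : (ZMod 2)[X]} {m : ℕ} (h : p.coeff m ≠ 0) : 2 ^ m ≤ polyBits p :=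
  Nat.two_pow_le_of_mem_bitIndices (Nat.mem_bitIndices.2 ((testBit_polyBits_iff p m).2 h))

/-- Over `𝔽₂` every nonzero polynomial is monic. [folklore] -/
theorem monic_of_ne_zero_zmod_two {p : (ZMod 2)[X]} (hp : p ≠ 0) : p.Monic := by
  have h := leadingCoeff_ne_zero.2 hp
  rw [Monic]
  generalize p.leadingCoeff = x at h ⊢
  revert x
  decide

/-- `bitsPoly n = 0` iff `n = 0`. [folklore] -/
theorem bitsPoly_eq_zero_iff {n : ℕ} : bitsPoly n = 0 ↔ n = 0 :=
  ⟨fun h => bitsPoly_injective (h.trans bitsPoly_zero.symm), fun h => h ▸ bitsPoly_zero⟩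

/-- `bitsPoly n = 1` iff `n = 1`. [folklore] -/
theorem bitsPoly_eq_one_iff {n : ℕ} : bitsPoly n = 1 ↔ n = 1 :=
  ⟨fun h => bitsPoly_injective (h.trans bitsPoly_one.symm), fun h => h ▸ bitsPoly_one⟩

/-- **Trial-division criterion, bitmask form** (for implementers of the search for `f_M`).
`bitsPoly n` is irreducible iff `n ≥ 2` (degree `≥ 1`) and no bitmask `q ≥ 2` with
`2·⌊log₂ q⌋ ≤ ⌊log₂ n⌋` (a degree between `1` and half the degree) gives a divisor
`bitsPoly q ∣ bitsPoly n` (`Polynomial.Monic.irreducible_iff_lt_natDegree_lt`; over `𝔽₂` all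
nonzero polynomials are monic, and every polynomial is some `bitsPoly q`). [folklore] -/
theorem irreducible_bitsPoly_iff (n : ℕ) :
    Irreducible (bitsPoly n) ↔
      2 ≤ n ∧ ∀ q, 2 ≤ q → 2 * Nat.log 2 q ≤ Nat.log 2 n → ¬(bitsPoly q ∣ bitsPoly n) := by
  rcases lt_or_ge n 2 with hn | hn
  · have h01 : n = 0 ∨ n = 1 := by omega
    rcases h01 with rfl | rfl
    · simp
    · simp
  · have h0 : bitsPoly n ≠ 0 := fun h => by rw [bitsPoly_eq_zero_iff] at h; omega
    have h1 : bitsPoly n ≠ 1 := fun h => by rw [bitsPoly_eq_one_iff] at h; omega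
    rw [(monic_of_ne_zero_zmod_two h0).irreducible_iff_lt_natDegree_lt h1, and_iff_right hn]
    constructor
    · intro h q hq hlog hdvd
      have hq0 : bitsPoly q ≠ 0 := fun h' => by rw [bitsPoly_eq_zero_iff] at h'; omega
      refine h (bitsPoly q) (monic_of_ne_zero_zmod_two hq0) ?_ hdvd
      rw [Finset.mem_Ioc, natDegree_bitsPoly, natDegree_bitsPoly]
      exact ⟨Nat.log_pos one_lt_two hq, by omega⟩
    · intro h q hq hdeg hdvd
      obtain ⟨k, rfl⟩ : ∃ k, q = bitsPoly k := ⟨polyBits q, (bitsPoly_polyBits q).symm⟩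
      rw [Finset.mem_Ioc, natDegree_bitsPoly, natDegree_bitsPoly] at hdeg
      refine h k ?_ (by omega) hdvd
      by_contra hlt
      have : Nat.log 2 k = 0 := Nat.log_eq_zero_iff.2 (Or.inl (by omega))
      omega

/-! ### The canonical irreducible polynomial of degree `M + 1` over `𝔽₂` -/

/-- **Existence of an irreducible binary polynomial of every degree `m ≥ 1`, in bitmask form**:
some `n ∈ [2^m, 2^{m+1})` has `bitsPoly n` irreducible — the minimal polynomial of a primitive
element of `GaloisField 2 m` (monic of degree `[GF(2^m) : 𝔽₂] = m`).
[cite: Mceliece2002, Ch. 9 §9.1] -/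
theorem exists_irreducible_bitsPoly (m : ℕ) (hm : m ≠ 0) :
    ∃ n, 2 ^ m ≤ n ∧ n < 2 ^ (m + 1) ∧ Irreducible (bitsPoly n) := by
  classical
  let K := GaloisField 2 m
  let pb : PowerBasis (ZMod 2) K := Field.powerBasisOfFiniteOfSeparable (ZMod 2) K
  have hint : IsIntegral (ZMod 2) pb.gen := pb.isIntegral_gen
  have hmonic : (minpoly (ZMod 2) pb.gen).Monic := minpoly.monic hint
  have hirr : Irreducible (minpoly (ZMod 2) pb.gen) := minpoly.irreducible hint
  have hdeg : (minpoly (ZMod 2) pb.gen).natDegree = m := by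
    rw [pb.natDegree_minpoly, ← pb.finrank, GaloisField.finrank 2 hm]
  refine ⟨polyBits (minpoly (ZMod 2) pb.gen), two_pow_le_polyBits ?_, polyBits_lt_two_pow ?_,
    by rwa [bitsPoly_polyBits]⟩
  · have h1 : (minpoly (ZMod 2) pb.gen).coeff (minpoly (ZMod 2) pb.gen).natDegree = 1 :=
      hmonic.coeff_natDegree
    rw [hdeg] at h1
    rw [h1]
    exact one_ne_zero
  · rw [degree_eq_natDegree hmonic.ne_zero, hdeg]
    exact_mod_cast Nat.lt_succ_self m

/-- **The bitmask of the canonical irreducible polynomial of degree `M + 1` over `𝔽₂`**: the LEAST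
`n ∈ [2^{M+1}, 2^{M+2})` with `bitsPoly n` irreducible (what the search "first irreducible
polynomial of degree `M+1` in increasing bitmask order" returns; e.g. `0b111 = X²+X+1` for
`M = 1`, `0b1011 = X³+X+1` for `M = 2`). [cite: Mceliece2002, Ch. 9 §9.1] -/
def canonIrredBits (M : ℕ) : ℕ := by
  classical exact Nat.find (exists_irreducible_bitsPoly (M + 1) M.succ_ne_zero)

/-- The defining property of `canonIrredBits M`. [folklore] -/
theorem canonIrredBits_spec (M : ℕ) :
    2 ^ (M + 1) ≤ canonIrredBits M ∧ canonIrredBits M < 2 ^ (M + 2) ∧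
      Irreducible (bitsPoly (canonIrredBits M)) := by
  classical
  exact Nat.find_spec (exists_irreducible_bitsPoly (M + 1) M.succ_ne_zero)

/-- Minimality of `canonIrredBits M`: no smaller bitmask of bit-length `M + 2` is irreducible.
[folklore] -/
theorem canonIrredBits_min (M : ℕ) {n : ℕ} (h1 : 2 ^ (M + 1) ≤ n) (hn : n < canonIrredBits M) :
    ¬Irreducible (bitsPoly n) := by
  classical
  intro hirr
  exact Nat.find_min (exists_irreducible_bitsPoly (M + 1) M.succ_ne_zero) hn
    ⟨h1, hn.trans (canonIrredBits_spec M).2.1, hirr⟩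

/-- Characterisation of `canonIrredBits M` as a least element (for implementers proving that a
search returns it). [folklore] -/
theorem canonIrredBits_eq_iff (M n : ℕ) :
    canonIrredBits M = n ↔ (2 ^ (M + 1) ≤ n ∧ n < 2 ^ (M + 2) ∧ Irreducible (bitsPoly n)) ∧
      ∀ n', 2 ^ (M + 1) ≤ n' → n' < n → ¬Irreducible (bitsPoly n') := by
  classical
  unfold canonIrredBits
  rw [Nat.find_eq_iff]
  constructor
  · rintro ⟨hP, hmin⟩
    exact ⟨hP, fun n' h1 hlt hirr => hmin n' hlt ⟨h1, hlt.trans hP.2.1, hirr⟩⟩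
  · rintro ⟨hP, hmin⟩
    exact ⟨hP, fun n' hlt hP' => hmin n' hP'.1 hlt hP'.2.2⟩

/-- **The canonical irreducible polynomial of degree `M + 1` over `𝔽₂`** (`f_M`; e.g. `X² + X + 1`,
`X³ + X + 1`, `X⁴ + X + 1` for `M = 1, 2, 3`). [cite: Mceliece2002, Ch. 9 §9.1] -/
def canonIrred (M : ℕ) : (ZMod 2)[X] :=
  bitsPoly (canonIrredBits M)

/-- `f_M` is irreducible. [folklore] -/
theorem irreducible_canonIrred (M : ℕ) : Irreducible (canonIrred M) :=
  (canonIrredBits_spec M).2.2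

/-- `f_M` has degree `M + 1`. [folklore] -/
theorem natDegree_canonIrred (M : ℕ) : (canonIrred M).natDegree = M + 1 :=
  natDegree_bitsPoly_of_mem (canonIrredBits_spec M).1 (canonIrredBits_spec M).2.1

/-- `f_M` is monic. [folklore] -/
theorem monic_canonIrred (M : ℕ) : (canonIrred M).Monic :=
  monic_bitsPoly_of_mem (canonIrredBits_spec M).1 (canonIrredBits_spec M).2.1

/-- The irreducibility of `f_M` as an instance (for `AdjoinRoot.instField`). [folklore] -/
instance fact_irreducible_canonIrred (M : ℕ) : Fact (Irreducible (canonIrred M)) :=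
  ⟨irreducible_canonIrred M⟩

/-! ### The field `GF(2^{M+1}) = 𝔽₂[X]/(f_M)` with its power basis -/

/-- **`GF(2^{M+1})`, explicitly**: `𝔽₂[X]/(f_M)` (a field since `f_M` is irreducible).
[cite: Mceliece2002, Ch. 9 §9.1] -/
abbrev GF2 (M : ℕ) : Type :=
  AdjoinRoot (canonIrred M)

namespace GF2

/-- `GF(2^{M+1})` has characteristic `2`. [folklore] -/
instance charP (M : ℕ) : CharP (GF2 M) 2 :=
  charP_of_injective_algebraMap (algebraMap (ZMod 2) (GF2 M)).injective 2

/-- **The power basis `1, x, …, x^M`** of `GF(2^{M+1})` over `𝔽₂` (`AdjoinRoot.powerBasisAux'`,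
reindexed by `natDegree f_M = M + 1`). [cite: Mceliece2002, Ch. 9 §9.1] -/
def basis (M : ℕ) : Module.Basis (Fin (M + 1)) (ZMod 2) (GF2 M) :=
  (AdjoinRoot.powerBasisAux' (monic_canonIrred M)).reindex (finCongr (natDegree_canonIrred M))

/-- **Coordinates are remainder coefficients**: the `l`-th coordinate of the class of `p` in the
power basis is the coefficient of `X^l` in `p mod f_M`. [cite: Mceliece2002, Ch. 9 §9.1] -/
theorem basis_repr_mk (M : ℕ) (p : (ZMod 2)[X]) (l : Fin (M + 1)) :
    (basis M).repr (AdjoinRoot.mk (canonIrred M) p) l = (p %ₘ canonIrred M).coeff l := by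
  rw [basis, Module.Basis.repr_reindex, Finsupp.mapDomain_equiv_apply,
    AdjoinRoot.powerBasisAux'_repr_apply_to_fun, AdjoinRoot.modByMonicHom_mk]
  simp

/-- The element of `GF(2^{M+1})` with coefficient bitmask `n`: the class of `bitsPoly n`.
[cite: Mceliece2002, Ch. 9 §9.1] -/
def elt (M n : ℕ) : GF2 M :=
  AdjoinRoot.mk (canonIrred M) (bitsPoly n)

/-- Distinct bitmasks `< 2^{M+1}` give distinct elements (their polynomials have degree `≤ M`,
and `f_M ∣ p - q` with `deg (p - q) < deg f_M` forces `p = q`). [folklore] -/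
theorem elt_injective {M n n' : ℕ} (hn : n < 2 ^ (M + 1)) (hn' : n' < 2 ^ (M + 1))
    (h : elt M n = elt M n') : n = n' := by
  have hdvd : canonIrred M ∣ bitsPoly n - bitsPoly n' := AdjoinRoot.mk_eq_mk.1 h
  have hdeg : (bitsPoly n - bitsPoly n').degree < (canonIrred M).degree := by
    rw [degree_eq_natDegree (monic_canonIrred M).ne_zero, natDegree_canonIrred]
    exact (degree_sub_le _ _).trans_lt (max_lt (degree_bitsPoly_lt hn) (degree_bitsPoly_lt hn'))
  have h0 := eq_zero_of_dvd_of_degree_lt hdvd hdeg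
  exact bitsPoly_injective (sub_eq_zero.1 h0)

/-- Nonzero bitmasks `< 2^{M+1}` give nonzero elements. [folklore] -/
theorem elt_ne_zero {M n : ℕ} (h0 : n ≠ 0) (hn : n < 2 ^ (M + 1)) : elt M n ≠ 0 := by
  intro h
  have h' : elt M n = elt M 0 := by rw [h, elt, bitsPoly_zero, map_zero]
  exact h0 (elt_injective hn (Nat.two_pow_pos _) h')

/-- Coordinates of powers of `elt M n`: coefficients of `(bitsPoly n)^e mod f_M`. [folklore] -/
theorem basis_repr_elt_pow (M n e : ℕ) (l : Fin (M + 1)) :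
    (basis M).repr (elt M n ^ e) l = ((bitsPoly n) ^ e %ₘ canonIrred M).coeff l := by
  rw [elt, ← map_pow, basis_repr_mk]

end GF2

/-! ### The explicit BCH matrix and Khot's Thm. 4.1 for it -/

/-- **The explicit binary BCH parity-check `{0,1}`-matrix** with `t·(M+1)` rows and `N` columns:
`bch01Matrix` (`BCHIndependence.lean`) over `GF(2^{M+1}) = 𝔽₂[X]/(f_M)` with the power basis and
the column locators `α_j = [bitsPoly (j+1)]`, `j < N` (the nonzero elements with bitmasks
`1, …, N`). Row `(s, l)`, column `j` holds the `l`-th coordinate of `α_j^{2s+1}`.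
[cite: Khot2005, Thm. 4.1] -/
def bchExplicit (t M N : ℕ) : Matrix (Fin t × Fin (M + 1)) (Fin N) ℤ :=
  bch01Matrix (fun j : Fin N => GF2.elt M (j + 1)) t (GF2.basis M)

/-- The entries of `bchExplicit` are `0` or `1`. [cite: Khot2005, Thm. 4.1] -/
theorem bchExplicit_entry (t M N : ℕ) (r : Fin t × Fin (M + 1)) (j : Fin N) :
    bchExplicit t M N r j = 0 ∨ bchExplicit t M N r j = 1 :=
  bch01Matrix_entry _ t _ r j

/-- **The entry formula** (what a machine computes): entry `((s, l), j)` of `bchExplicit t M N` is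
the coefficient of `X^l` in `(bitsPoly (j+1))^{2s+1} mod f_M`, read as the integer `0` or `1`.
[cite: Mceliece2002, Ch. 9 §9.1] -/
theorem bchExplicit_apply (t M N : ℕ) (s : Fin t) (l : Fin (M + 1)) (j : Fin N) :
    bchExplicit t M N (s, l) j =
      ((((bitsPoly ((j : ℕ) + 1)) ^ (2 * (s : ℕ) + 1) %ₘ canonIrred M).coeff l).val : ℤ) := by
  simp only [bchExplicit, bch01Matrix, bchParity, Matrix.map_apply, Matrix.of_apply]
  rw [GF2.basis_repr_elt_pow]

/-- **Khot 2005, Thm. 4.1, for the explicit matrix** (`h = t·(M+1)` rows, `N < 2^{M+1}` columns,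
`d = 2t`): every integer vector with at least one and at most `2t` odd entries has an image under
`bchExplicit t M N` with an odd coordinate — any `d` columns are linearly independent over
`GF(2)` (`bch01Matrix_odd` for distinct nonzero locators). This is the hypothesis `Khot.DWise P d`
of `KhotBasicReduction.lean` for `P = bchExplicit t M N`. [cite: Khot2005, Thm. 4.1] -/
theorem bchExplicit_odd {t M N : ℕ} (hN : N < 2 ^ (M + 1)) (z : Fin N → ℤ) (hodd : ∃ i, Odd (z i))
    (hcard : (univ.filter fun i => Odd (z i)).card ≤ 2 * t) :
    ∃ r, Odd ((bchExplicit t M N *ᵥ z) r) := by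
  refine bch01Matrix_odd (fun j j' h => ?_) (fun j => GF2.elt_ne_zero (Nat.succ_ne_zero _) ?_) t _ z
    hodd hcard
  · exact Fin.ext (Nat.succ_injective (GF2.elt_injective (by omega) (by omega) h))
  · omega

/-- The explicit matrix witnesses `exists_bch01Matrix` (same statement, for `m = M + 1` and
`N + 1 ≤ 2^{M+1}`). [cite: Khot2005, Thm. 4.1] -/
theorem bchExplicit_spec (t M N : ℕ) (hN : N + 1 ≤ 2 ^ (M + 1)) :
    (∀ r i, bchExplicit t M N r i = 0 ∨ bchExplicit t M N r i = 1) ∧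
      ∀ z : Fin N → ℤ, (∃ i, Odd (z i)) → (univ.filter fun i => Odd (z i)).card ≤ 2 * t →
        ∃ r, Odd ((bchExplicit t M N *ᵥ z) r) :=
  ⟨bchExplicit_entry t M N, fun z hodd hcard => bchExplicit_odd (by omega) z hodd hcard⟩

end Literature.InformationTheory.Coding
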